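import Summits.HodgeConjecture.HodgeConjecture.Theorems.F0LD1ThetaArchBoxStep
import Summits.HodgeConjecture.HodgeConjecture.Theorems.F0LD1ThetaArchLadder
import HarnessLib

-- statements over the theta-kernel datum elaborate to very large types; elaborate sequentially (as in the ★ kit lineage)
set_option Elab.async false

/-!
# (Gα-C∞) THE BRICK `ArchLadder` FROM THE LOCAL BOX MOVES AT THE PLACE OF `ι` (line LD1 of crux HLiu418; owner A-p16 (g35); plate (P4-class),
# re-based on ★ `F0LD1ThetaArchBoxStep` (A-p13 (g40), FILE C-pre))

Cell hodgecm-mathlib, floor 0; namespace `Summit.HodgeConjecture.HodgeConjecture.Cruxes.HLiu418.F0LD1ThetaArchLadderOfBox`; `--supports stmt-HodgeConjecture-24832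
--as helper`.  THEOREMS ONLY (no definition, no instance, no notation, no `sorry`).

* §4 **`thetaClass_follandHermite_mem_of_box`** (over the kit binders of ★ (P2c), pin `(t) (ht) (g) (hg) (hpin)` included): `Q ⊆ L²([U(H)], ν)` closed
  `R`-invariant, `[θ_{h_β ⊗ Φ_f}] ∈ Q`, `u ∈ U(σ_{w₀} diag dV)(ℂ)` ANY element at ANY real place `v₀` whose Folland section satisfies the BOX IDENTITY `hS` (the `hS` of
  ★ T2 `pairRep_chiSplittingLine_adelicSingle_tmul_of_box` VERBATIM, at `a₁ := h_β`, `a₁' := Ψ`, `a₂ := h_0`) with scalar `c ≠ 0`, and `piCoeff γ (frameV_* Ψ) ≠ 0`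
  ⟹ `[θ_{h_γ ⊗ Φ_f}] ∈ Q` — ★ `F0LD1ThetaArchBoxStep.thetaClass_follandHermite_mem_of_box_of_coeff_ne_zero` (A-p13) with `k` from the pin (★
  `exists_archLocal_pin_adelicSingle_eq`), the torus hom through the pin (★ `exists_continuous_archTorusHom`), the Haar probability on `T_∞`
  (★ `exists_borel_haarProbability`), the character representation of type `c_γ` (★ `exists_charRep_prod_prod_zpow`) and the type `hμ.infinityType` of the
  splitting character, exactly as in ★ (P2c) `F0LD1ThetaArchDefiniteTransitivity`; `piCoeff γ F = hermiteCoeff γ (euclE_*⁻¹ F)` is `rfl`.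
* §5 **`archLadder_of_boxMoves`**: the brick ★ `F0LD1ThetaDichotomyOfBricks.ArchLadder` from the purely LOCAL statement «at a real place `v₀` with one positive
  (`kp`) and one non-positive (`km`) frame coordinate, for every `β` some `u`, `Ψ`, `c ≠ 0` satisfy `hS` with `piCoeff (β + e_{kp,v₀} + e_{km,v₀}) (frameV_* Ψ) ≠ 0`,
  and, when `β_{kp,v₀}, β_{km,v₀} > 0`, some with `piCoeff (β − e_{kp,v₀} − e_{km,v₀}) (frameV_* Ψ) ≠ 0`» (the boost of the `U(1,1)`-place read in the doubled
  model: (P4a)–(P4d) of LD1-p02 (g4), [KashiwaraVergne1978, §6], [KonnoKonno2007, Thm. 5.4]) — §4 twice inside ★ `archLadder_of_iotaStep`.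
Nothing printed is discharged; HC_CM is proved only modulo the 7 printed citations (2 remaining: hLiu418 = stmt-HodgeConjecture-24832, h413 =
stmt-HodgeConjecture-24833) until rung 0 closes; count-neutral.

References (prose locators): Folland 1989 §1.7, §4.2 Prop. (4.39), Ch. 4 §5; Konno–Konno 2007 Thm. 5.4; Kashiwara–Vergne 1978 §6 (6.3), §7 (7.2); Howe 1989 §3;
Bröcker–tom Dieck 1985 III (5.10).
-/

set_option autoImplicit false
set_option linter.dupNamespace false

noncomputable section

open NumberField NumberField.InfinitePlace MeasureTheory IsDedekindDomain
open scoped Matrix ComplexOrder ENNReal TensorProduct SchwartzMap Kronecker Classical ComplexConjugate InnerProductSpace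

namespace Summit.HodgeConjecture.HodgeConjecture.Cruxes.HLiu418.F0LD1ThetaArchLadderOfBox

open _root_.MeasureTheory
open Literature.NumberTheory.Automorphic Literature.NumberTheory.Automorphic.UnitaryGroup
open Literature.NumberTheory.Automorphic.UnitaryGroup.CotangentForms
open Literature.NumberTheory.Automorphic.IdeleClassGroup
open Literature.NumberTheory.Automorphic.Liu2021
open Literature.NumberTheory.Automorphic.Liu2021.Def411WeilCarriers
open Literature.NumberTheory.Automorphic.Liu2021.Def411WeilCarriersDoubling
open Literature.NumberTheory.Automorphic.Liu2021.CinfThetaTorus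
open Literature.NumberTheory.GelbartRogawski1991 Literature.NumberTheory.GelbartRogawski1991.UnitaryDualPair
open Literature.NumberTheory.GelbartRogawski1991.GRConstruction
open Literature.NumberTheory.Weil1964
open Literature.RepresentationTheory.Liu2021
open Literature.RepresentationTheory.HeisenbergGroup Literature.Analysis.SegalBargmann
open Literature.RepresentationTheory.KonnoKonno2007 Literature.RepresentationTheory.KonnoKonno2007.RealDualPair
open Literature.RepresentationTheory.CompactGroups
open Summit.HodgeConjecture.HodgeConjecture.Cruxes.HLiu418.F0LD1ThetaTransportKit
open Summit.HodgeConjecture.HodgeConjecture.Cruxes.HLiu418.F0LD2ThetaTensorClasses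
open Summit.HodgeConjecture.HodgeConjecture.Cruxes.HLiu418.F0LD1ArchTorusHom
open Summit.HodgeConjecture.HodgeConjecture.Cruxes.HLiu418.F0LD1ThetaClassTorusExtraction
open Summit.HodgeConjecture.HodgeConjecture.Cruxes.HLiu418.F0LD1ThetaSliceTorusProjector (exists_charRep_prod_prod_zpow charProj_restrict_mem_closedSubrep)
open Summit.HodgeConjecture.HodgeConjecture.Cruxes.HLiu418.F0LD2PinnedArchSingleTransport (exists_archLocal_pin_adelicSingle_eq)
open Summit.HodgeConjecture.HodgeConjecture.Cruxes.HLiu418.F0LD1ThetaArchCompactStep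
open Summit.HodgeConjecture.HodgeConjecture.Cruxes.HLiu418.F0LD1ThetaArchCompactStepNeg
open Summit.HodgeConjecture.HodgeConjecture.Cruxes.HLiu418.F0LD1ThetaClassHermiteSum
open Summit.HodgeConjecture.HodgeConjecture.Cruxes.HLiu418.F0LD1ThetaDichotomyOfBricks
open Summit.HodgeConjecture.HodgeConjecture.Cruxes.HLiu418.F0LD1ThetaArchLadder
open Summit.HodgeConjecture.HodgeConjecture.Cruxes.HLiu418.F0LD1ThetaArchBoxStep
open Summit.HodgeConjecture.HodgeConjecture.Cruxes.HLiu418.F0LD2FrameTransportPin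
open Summit.HodgeConjecture.HodgeConjecture.Cruxes.HLiu418.F0LD1ThetaGermDefs

/-! ## §4 Membership from a box identity, pin and torus discharged (kit binders of ★ (P2c)) -/

section Kit

variable (L : Type) [Field L] [NumberField L] [IsCMField L] (N : ℕ) (H : Matrix (Fin N) (Fin N) L)
  {n' : ℕ} (e₁ : Fin N × Fin 1 ≃ Fin n') (dV : Fin N → L) (hdV : ∀ i, IsCMField.complexConj L (dV i) = dV i)
  (hdV0 : ∀ i, dV i ≠ 0)
  (ιA : (adelicGroupData (↥(maximalRealSubfield L)) L (IsCMField.complexConj L) N H).Adelic →*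
    ↥(UnitaryGroup.adelic (↥(maximalRealSubfield L)) L (IsCMField.complexConj L) N (Matrix.diagonal dV)))
  (hιA : Continuous ιA ∧ ∀ ⦃γ : (adelicGroupData (↥(maximalRealSubfield L)) L (IsCMField.complexConj L) N H).Adelic⦄,
    γ ∈ (UnitaryGroup.toAdelic (↥(maximalRealSubfield L)) L (IsCMField.complexConj L) N H).range →
      ιA γ ∈ (UnitaryGroup.toAdelic (↥(maximalRealSubfield L)) L (IsCMField.complexConj L) N (Matrix.diagonal dV)).range)
  (μ : Literature.NumberTheory.Automorphic.IdeleClassGroup L →ₜ* Circle) (hμ : IsConjugateSymplectic L μ) (a : (↥(maximalRealSubfield L))ˣ)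
  (hρ : HasThetaMajorants fun
      (p : ↥(UnitaryGroup.adelic (↥(maximalRealSubfield L)) L (IsCMField.complexConj L) N (Matrix.diagonal dV)) ×
        ↥(UnitaryGroup.adelic (↥(maximalRealSubfield L)) L (IsCMField.complexConj L) 1 (JW (↥(maximalRealSubfield L)) L a)))
      (Φ : piSchwartzBruhat (↥(maximalRealSubfield L)) (Fin n')) =>
        pairRep (↥(maximalRealSubfield L)) L (IsCMField.complexConj L) N 1 e₁ (Matrix.diagonal dV) (JW (↥(maximalRealSubfield L)) L a)
          (chiSplittingLine L e₁ dV hdV hdV0 (toHeckeCharacter L μ) (isUnitary_toHeckeCharacter L μ)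
            ((isOscillatorChar_toHeckeCharacter_iff μ).mpr hμ) (TW (↥(maximalRealSubfield L)) a)
            (isUnit_det_TW (↥(maximalRealSubfield L)) a) (JW (↥(maximalRealSubfield L)) L a) (JW_eq (↥(maximalRealSubfield L)) L a))
          p Φ)
  [CompactSpace (↥(UnitaryGroup.adelic (↥(maximalRealSubfield L)) L (IsCMField.complexConj L) N (Matrix.diagonal dV)) ⧸
    (UnitaryGroup.toAdelic (↥(maximalRealSubfield L)) L (IsCMField.complexConj L) N (Matrix.diagonal dV)).range)]
  [MeasurableSpace (↥(UnitaryGroup.adelic (↥(maximalRealSubfield L)) L (IsCMField.complexConj L) 1 (JW (↥(maximalRealSubfield L)) L a)) ⧸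
    (UnitaryGroup.toAdelic (↥(maximalRealSubfield L)) L (IsCMField.complexConj L) 1 (JW (↥(maximalRealSubfield L)) L a)).range)]
  (μW : Measure (↥(UnitaryGroup.adelic (↥(maximalRealSubfield L)) L (IsCMField.complexConj L) 1 (JW (↥(maximalRealSubfield L)) L a)) ⧸
    (UnitaryGroup.toAdelic (↥(maximalRealSubfield L)) L (IsCMField.complexConj L) 1 (JW (↥(maximalRealSubfield L)) L a)).range))
  (f : C((↥(UnitaryGroup.adelic (↥(maximalRealSubfield L)) L (IsCMField.complexConj L) 1 (JW (↥(maximalRealSubfield L)) L a)) ⧸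
    (UnitaryGroup.toAdelic (↥(maximalRealSubfield L)) L (IsCMField.complexConj L) 1 (JW (↥(maximalRealSubfield L)) L a)).range), ℂ))
  [BorelSpace (↥(UnitaryGroup.adelic (↥(maximalRealSubfield L)) L (IsCMField.complexConj L) 1 (JW (↥(maximalRealSubfield L)) L a)) ⧸
    (UnitaryGroup.toAdelic (↥(maximalRealSubfield L)) L (IsCMField.complexConj L) 1 (JW (↥(maximalRealSubfield L)) L a)).range)]
  [IsFiniteMeasure μW]
  [CompactSpace (adelicGroupData (↥(maximalRealSubfield L)) L (IsCMField.complexConj L) N H).automorphicQuotient]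
  (ν : Measure (adelicGroupData (↥(maximalRealSubfield L)) L (IsCMField.complexConj L) N H).automorphicQuotient)
  [(adelicGroupData (↥(maximalRealSubfield L)) L (IsCMField.complexConj L) N H).IsAutomorphicMeasure ν]
  (t : L) (ht : t ≠ 0) (g : GL (Fin N) L)
  (hg : formCongr ((IsCMField.complexConj L : L ≃ₐ[↥(maximalRealSubfield L)] L) : L →+* L) g (t • H) = Matrix.diagonal dV)
  (hpin : ∀ k, ((ιA k : ↥(UnitaryGroup.adelic (↥(maximalRealSubfield L)) L (IsCMField.complexConj L) N (Matrix.diagonal dV))) :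
      GL (Fin N) (AdeleRing (𝓞 L) L)) =
    (toAdeleGL L g)⁻¹ * adelicVal (↥(maximalRealSubfield L)) L (IsCMField.complexConj L) N H k * toAdeleGL L g)

include hιA ht hg hpin

set_option maxHeartbeats 1600000 in
/-- **§4 MEMBERSHIP FROM A BOX IDENTITY (pin, torus and type discharged).**  `Q` closed `R`-invariant, `[θ_{h_β ⊗ Φ_f}] ∈ Q`, `u ∈ U(σ_{w₀} diag dV)(ℂ)` ANY element at ANY real place `v₀` whose
section satisfies the box identity `hS` with output `Ψ` and scalar `c ≠ 0`, and `piCoeff γ (frameV_* Ψ) ≠ 0` ⟹ `[θ_{h_γ ⊗ Φ_f}] ∈ Q` — ★ `thetaClass_follandHermite_mem_of_box_of_coeff_ne_zero` (A-p13) with `k` from the pin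
(★ `exists_archLocal_pin_adelicSingle_eq`), the torus hom through the pin (★ `exists_continuous_archTorusHom`), the Haar probability on `T_∞`, the character representation of
type `c_γ` (★ `exists_charRep_prod_prod_zpow`) and the type `hμ.infinityType` of the splitting character. [cite: KashiwaraVergne1978, §6 (6.3)] [cite: Howe1989, §3]
[cite: Folland1989, Ch. 4 §5] [cite: KonnoKonno2007, Thm. 5.4] -/
theorem thetaClass_follandHermite_mem_of_box (v₀ : {v : InfinitePlace (↥(maximalRealSubfield L)) // v.IsReal})
    (u : UnitaryGroup.archLocal L N (Matrix.diagonal dV) (cmPlaceOver L v₀))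
    (β : (Fin n' × {v : InfinitePlace (↥(maximalRealSubfield L)) // v.IsReal}) →₀ ℕ) {Ψ : 𝓢((Fin n' → mixedEmbedding.mixedSpace (↥(maximalRealSubfield L))), ℂ)} {c : ℂ}
    (hS : carrierConjEquiv (frameD L e₁ dV hdV hdV0 (lineW L (TW (Fp L) a)) (complexConj_lineW L (TW (Fp L) a)) (lineW_ne_zero L (TW (Fp L) a) (isUnit_det_TW (Fp L) a)))
        (sectionD L e₁ dV hdV hdV0 (lineW L (TW (Fp L) a)) (complexConj_lineW L (TW (Fp L) a)) (lineW_ne_zero L (TW (Fp L) a) (isUnit_det_TW (Fp L) a))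
          (archKPlace L e₁ dV hdV (lineW L (TW (Fp L) a)) (complexConj_lineW L (TW (Fp L) a)) v₀ u)).1.2
          (schwartzReindexCLM (Fp L) (e₂ (n := n')) (archBoxTensor (follandHermite (frameV L e₁ dV hdV hdV0 (lineW L (TW (Fp L) a)) (complexConj_lineW L (TW (Fp L) a)) (lineW_ne_zero L (TW (Fp L) a) (isUnit_det_TW (Fp L) a))) β) (follandHermite (frameV L e₁ dV hdV hdV0 (lineW L (TW (Fp L) a)) (complexConj_lineW L (TW (Fp L) a)) (lineW_ne_zero L (TW (Fp L) a) (isUnit_det_TW (Fp L) a))) 0))) =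
      c • schwartzReindexCLM (Fp L) (e₂ (n := n')) (archBoxTensor Ψ (follandHermite (frameV L e₁ dV hdV hdV0 (lineW L (TW (Fp L) a)) (complexConj_lineW L (TW (Fp L) a)) (lineW_ne_zero L (TW (Fp L) a) (isUnit_det_TW (Fp L) a))) 0)))
    (hc : c ≠ 0) (γ : (Fin n' × {v : InfinitePlace (↥(maximalRealSubfield L)) // v.IsReal}) →₀ ℕ) (Φf : FinSB (↥(maximalRealSubfield L)) (Fin n'))
    (hγ : piCoeff γ (schwartzTransport (frameV L e₁ dV hdV hdV0 (lineW L (TW (Fp L) a)) (complexConj_lineW L (TW (Fp L) a)) (lineW_ne_zero L (TW (Fp L) a) (isUnit_det_TW (Fp L) a))) Ψ) ≠ 0)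
    (Q : ContRepresentation.ClosedSubrep ((adelicGroupData (↥(maximalRealSubfield L)) L (IsCMField.complexConj L) N H).rightRegular ν))
    (hQ : MemLp.toLp _ (memLp_toQuotFun_lineThetaLift L N H e₁ dV hdV hdV0 ιA hιA μ hμ a hρ μW
          (piSchwartzBruhatEquiv (↥(maximalRealSubfield L)) (Fin n')
            (follandHermite (frameV L e₁ dV hdV hdV0 (lineW L (TW (Fp L) a)) (complexConj_lineW L (TW (Fp L) a)) (lineW_ne_zero L (TW (Fp L) a) (isUnit_det_TW (Fp L) a))) β ⊗ₜ Φf)) f ν 2) ∈ Q) :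
    MemLp.toLp _ (memLp_toQuotFun_lineThetaLift L N H e₁ dV hdV hdV0 ιA hιA μ hμ a hρ μW
          (piSchwartzBruhatEquiv (↥(maximalRealSubfield L)) (Fin n')
            (follandHermite (frameV L e₁ dV hdV hdV0 (lineW L (TW (Fp L) a)) (complexConj_lineW L (TW (Fp L) a)) (lineW_ne_zero L (TW (Fp L) a) (isUnit_det_TW (Fp L) a))) γ ⊗ₜ Φf)) f ν 2) ∈ Q := by
  -- the archimedean type of the splitting character
  have hτ : (toHeckeCharacter L μ).HasUnitaryArchType hμ.infinityType 0 :=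
    (hasUnitaryArchType_toHeckeCharacter_iff L μ _).2 hμ.hasInfinityType_infinityType
  have hodd : ∀ w, Odd (hμ.infinityType w) := hμ.odd_infinityType
  -- the archimedean torus hom through the pin, the Haar probability on `T_∞`, orbit continuity and unitarity of `R|_{T_∞}`
  obtain ⟨kT, hkTc, hkT, -, -⟩ := exists_continuous_archTorusHom L N H dV t ht g hg ιA hpin
  obtain ⟨mT, bT, μT, hprob, hinv⟩ := exists_borel_haarProbability L N
  letI : MeasurableSpace (({v : InfinitePlace (↥(maximalRealSubfield L)) // v.IsReal}) → Fin N → Circle) := mT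
  haveI : BorelSpace (({v : InfinitePlace (↥(maximalRealSubfield L)) // v.IsReal}) → Fin N → Circle) := bT
  haveI : IsProbabilityMeasure μT := hprob
  haveI : μT.IsMulLeftInvariant := hinv
  have hU : ∀ w, Continuous fun z : (({v : InfinitePlace (↥(maximalRealSubfield L)) // v.IsReal}) → Fin N → Circle) =>
      (((adelicGroupData (↥(maximalRealSubfield L)) L (IsCMField.complexConj L) N H).rightRegular ν).restrict kT) z w := fun w => by
    simp only [ContRepresentation.restrict_apply]
    exact (AdelicGroupData.isStronglyContinuous_rightRegular_holds (adelicGroupData (↥(maximalRealSubfield L)) L (IsCMField.complexConj L) N H) ν w).comp hkTc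
  have hUu : ∀ (z : (({v : InfinitePlace (↥(maximalRealSubfield L)) // v.IsReal}) → Fin N → Circle))
      (w w' : (adelicGroupData (↥(maximalRealSubfield L)) L (IsCMField.complexConj L) N H).L2 ν),
      ⟪(((adelicGroupData (↥(maximalRealSubfield L)) L (IsCMField.complexConj L) N H).rightRegular ν).restrict kT) z w,
        (((adelicGroupData (↥(maximalRealSubfield L)) L (IsCMField.complexConj L) N H).rightRegular ν).restrict kT) z w'⟫_ℂ = ⟪w, w'⟫_ℂ :=
    fun z w w' => by
    rw [ContRepresentation.restrict_apply]
    exact (AdelicGroupData.isUnitary_rightRegular (adelicGroupData (↥(maximalRealSubfield L)) L (IsCMField.complexConj L) N H) ν).inner_map_map (kT z) w w'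
  -- the character representation of the type of `γ`
  obtain ⟨κ, hκ, hκirr, hκu, hκc⟩ := exists_charRep_prod_prod_zpow
    (fun (v : {v : InfinitePlace (↥(maximalRealSubfield L)) // v.IsReal}) (p : Fin N) =>
      (if 0 < signVec (cmPlaceOver L) (cmGramEntry L e₁ dV hdV (lineW L (TW (Fp L) a)) (complexConj_lineW L (TW (Fp L) a))) (imagUnit L) v (e₁ (p, 0))
        then (hμ.infinityType (cmPlaceOver L v).1 + 1) / 2 + (γ (e₁ (p, 0), v) : ℤ)
        else (hμ.infinityType (cmPlaceOver L v).1 + 1) / 2 - 1 - (γ (e₁ (p, 0), v) : ℤ)))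
  haveI := hκirr
  -- `k` through the pin
  obtain ⟨k, hk, -⟩ := exists_archLocal_pin_adelicSingle_eq L N H dV t ht g hg ιA hpin (cmPlaceOver L v₀) u
  exact thetaClass_follandHermite_mem_of_box_of_coeff_ne_zero L N H e₁ dV hdV hdV0 ιA hιA μ hμ a hρ μW f ν v₀ hτ hodd u β γ hS hc hγ _ hk Φf kT hkT μT
    hκ hκu hκc hU hUu Q hQ

end Kit

/-! ## §5 The brick `ArchLadder` from the LOCAL box moves at the place of `ι` -/

set_option maxHeartbeats 1600000 in
/-- **§5 THE BRICK FROM THE LOCAL BOX MOVES.**  If at every real place `v₀` with one positive (`kp`) and one non-positive (`km`) frame coordinate, for every Hermite index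
`β` some `u ∈ U(σ diag dV)(ℂ)`, `Ψ`, `c ≠ 0` satisfy the box identity with `piCoeff (β + e_{kp,v₀} + e_{km,v₀}) (frameV_* Ψ) ≠ 0`, and — when `β_{kp,v₀}, β_{km,v₀} > 0` — some with
`piCoeff (β − e_{kp,v₀} − e_{km,v₀}) (frameV_* Ψ) ≠ 0` (the boost of the `U(1,1)`-place read in the doubled model: (P4a)–(P4d)), then `ArchLadder` holds (§4 twice inside
★ `archLadder_of_iotaStep`). [cite: KashiwaraVergne1978, §6 (6.3), §7 (7.2)] [cite: KonnoKonno2007, Thm. 5.4] [cite: Howe1989, §3] -/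
theorem archLadder_of_boxMoves
    (hbox : ∀ (L : Type) [Field L] [NumberField L] [IsCMField L] {n' : ℕ} (e₁ : Fin 2 × Fin 1 ≃ Fin n') (dV : Fin 2 → L)
      (hdV : ∀ i, IsCMField.complexConj L (dV i) = dV i) (hdV0 : ∀ i, dV i ≠ 0) (a' : (↥(maximalRealSubfield L))ˣ)
      (v₀ : {v : InfinitePlace (↥(maximalRealSubfield L)) // v.IsReal}) (kp km : Fin n')
      (_hkp : 0 < signVec (cmPlaceOver L) (cmGramEntry L e₁ dV hdV (lineW L (TW (Fp L) a')) (complexConj_lineW L (TW (Fp L) a'))) (imagUnit L) v₀ kp) (_hkm : ¬ 0 < signVec (cmPlaceOver L) (cmGramEntry L e₁ dV hdV (lineW L (TW (Fp L) a')) (complexConj_lineW L (TW (Fp L) a'))) (imagUnit L) v₀ km)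
      (β : (Fin n' × {v : InfinitePlace (↥(maximalRealSubfield L)) // v.IsReal}) →₀ ℕ),
      (∃ (u : UnitaryGroup.archLocal L 2 (Matrix.diagonal dV) (cmPlaceOver L v₀)) (Ψ : 𝓢((Fin n' → mixedEmbedding.mixedSpace (↥(maximalRealSubfield L))), ℂ)) (c : ℂ),
        c ≠ 0 ∧
          carrierConjEquiv (frameD L e₁ dV hdV hdV0 (lineW L (TW (Fp L) a')) (complexConj_lineW L (TW (Fp L) a')) (lineW_ne_zero L (TW (Fp L) a') (isUnit_det_TW (Fp L) a')))
            (sectionD L e₁ dV hdV hdV0 (lineW L (TW (Fp L) a')) (complexConj_lineW L (TW (Fp L) a')) (lineW_ne_zero L (TW (Fp L) a') (isUnit_det_TW (Fp L) a'))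
              (archKPlace L e₁ dV hdV (lineW L (TW (Fp L) a')) (complexConj_lineW L (TW (Fp L) a')) v₀ u)).1.2
              (schwartzReindexCLM (Fp L) (e₂ (n := n')) (archBoxTensor (follandHermite (frameV L e₁ dV hdV hdV0 (lineW L (TW (Fp L) a')) (complexConj_lineW L (TW (Fp L) a')) (lineW_ne_zero L (TW (Fp L) a') (isUnit_det_TW (Fp L) a'))) β) (follandHermite (frameV L e₁ dV hdV hdV0 (lineW L (TW (Fp L) a')) (complexConj_lineW L (TW (Fp L) a')) (lineW_ne_zero L (TW (Fp L) a') (isUnit_det_TW (Fp L) a'))) 0))) =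
            c • schwartzReindexCLM (Fp L) (e₂ (n := n')) (archBoxTensor Ψ (follandHermite (frameV L e₁ dV hdV hdV0 (lineW L (TW (Fp L) a')) (complexConj_lineW L (TW (Fp L) a')) (lineW_ne_zero L (TW (Fp L) a') (isUnit_det_TW (Fp L) a'))) 0)) ∧
          piCoeff (β + (Finsupp.single (kp, v₀) 1 + Finsupp.single (km, v₀) 1)) (schwartzTransport (frameV L e₁ dV hdV hdV0 (lineW L (TW (Fp L) a')) (complexConj_lineW L (TW (Fp L) a')) (lineW_ne_zero L (TW (Fp L) a') (isUnit_det_TW (Fp L) a'))) Ψ) ≠ 0) ∧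
      (0 < β (kp, v₀) → 0 < β (km, v₀) →
        ∃ (u : UnitaryGroup.archLocal L 2 (Matrix.diagonal dV) (cmPlaceOver L v₀)) (Ψ : 𝓢((Fin n' → mixedEmbedding.mixedSpace (↥(maximalRealSubfield L))), ℂ)) (c : ℂ),
          c ≠ 0 ∧
            carrierConjEquiv (frameD L e₁ dV hdV hdV0 (lineW L (TW (Fp L) a')) (complexConj_lineW L (TW (Fp L) a')) (lineW_ne_zero L (TW (Fp L) a') (isUnit_det_TW (Fp L) a')))
            (sectionD L e₁ dV hdV hdV0 (lineW L (TW (Fp L) a')) (complexConj_lineW L (TW (Fp L) a')) (lineW_ne_zero L (TW (Fp L) a') (isUnit_det_TW (Fp L) a'))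
              (archKPlace L e₁ dV hdV (lineW L (TW (Fp L) a')) (complexConj_lineW L (TW (Fp L) a')) v₀ u)).1.2
              (schwartzReindexCLM (Fp L) (e₂ (n := n')) (archBoxTensor (follandHermite (frameV L e₁ dV hdV hdV0 (lineW L (TW (Fp L) a')) (complexConj_lineW L (TW (Fp L) a')) (lineW_ne_zero L (TW (Fp L) a') (isUnit_det_TW (Fp L) a'))) β) (follandHermite (frameV L e₁ dV hdV hdV0 (lineW L (TW (Fp L) a')) (complexConj_lineW L (TW (Fp L) a')) (lineW_ne_zero L (TW (Fp L) a') (isUnit_det_TW (Fp L) a'))) 0))) =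
            c • schwartzReindexCLM (Fp L) (e₂ (n := n')) (archBoxTensor Ψ (follandHermite (frameV L e₁ dV hdV hdV0 (lineW L (TW (Fp L) a')) (complexConj_lineW L (TW (Fp L) a')) (lineW_ne_zero L (TW (Fp L) a') (isUnit_det_TW (Fp L) a'))) 0)) ∧
            piCoeff (β - (Finsupp.single (kp, v₀) 1 + Finsupp.single (km, v₀) 1)) (schwartzTransport (frameV L e₁ dV hdV hdV0 (lineW L (TW (Fp L) a')) (complexConj_lineW L (TW (Fp L) a')) (lineW_ne_zero L (TW (Fp L) a') (isUnit_det_TW (Fp L) a'))) Ψ) ≠ 0)) :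
    ArchLadder := by
  refine archLadder_of_iotaStep ?_
  intro L _ _ _ ι H dV hdV hdV0 t ht g hg _ hdef hdeg μ _ n' e₁ lam hlam _ ιA hpin _ a' ξ hρ μW _ _ Φf v₀ _ kp km hkp hkm Q β hβ
  -- the brick prefix's inline data, as in ★ `archLadder_of_iotaStep`
  haveI : CompactSpace (adelicGroupData (↥(maximalRealSubfield L)) L (IsCMField.complexConj L) 2 H).automorphicQuotient :=
    (UnitaryGroup.exists_infinitePlace_ne L hdeg ι).elim fun τ hτ =>
      UnitaryGroup.compactSpace_adelicGroupData_automorphicQuotient L 2 H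
        (UnitaryGroup.anisotropic_of_formCongr_smul_eq_of_posDef L 2 H dV t ht g hg τ (hdef τ hτ))
  have hT : Continuous ιA ∧ ∀ ⦃γ : (adelicGroupData (↥(maximalRealSubfield L)) L (IsCMField.complexConj L) 2 H).Adelic⦄,
      γ ∈ (UnitaryGroup.toAdelic (↥(maximalRealSubfield L)) L (IsCMField.complexConj L) 2 H).range →
        ιA γ ∈ (UnitaryGroup.toAdelic (↥(maximalRealSubfield L)) L (IsCMField.complexConj L) 2 (Matrix.diagonal dV)).range :=
    ⟨continuous_of_pin L 2 H dV g ιA hpin, fun _ hγ => mem_range_toAdelic_of_pin L 2 H dV t ht g hg ιA hpin hγ⟩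
  letI : MeasurableSpace (↥(UnitaryGroup.adelic (↥(maximalRealSubfield L)) L (IsCMField.complexConj L) 1 (JW (↥(maximalRealSubfield L)) L a')) ⧸
      (UnitaryGroup.toAdelic (↥(maximalRealSubfield L)) L (IsCMField.complexConj L) 1 (JW (↥(maximalRealSubfield L)) L a')).range) := borel _
  haveI : BorelSpace (↥(UnitaryGroup.adelic (↥(maximalRealSubfield L)) L (IsCMField.complexConj L) 1 (JW (↥(maximalRealSubfield L)) L a')) ⧸
      (UnitaryGroup.toAdelic (↥(maximalRealSubfield L)) L (IsCMField.complexConj L) 1 (JW (↥(maximalRealSubfield L)) L a')).range) := ⟨rfl⟩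
  haveI := normal_range_toAdelic_JW L a'
  obtain ⟨hup, hdown⟩ := hbox L e₁ dV hdV hdV0 a' v₀ kp km hkp hkm β
  refine ⟨?_, fun h1 h2 => ?_⟩
  · obtain ⟨u, Ψ, c, hc, hS, hγ⟩ := hup
    exact thetaClass_follandHermite_mem_of_box L 2 H e₁ dV hdV hdV0 ιA hT lam hlam a' hρ μW (charCM ξ) μ t ht g hg hpin v₀ u β hS hc _ Φf hγ Q hβ
  · obtain ⟨u, Ψ, c, hc, hS, hγ⟩ := hdown h1 h2
    exact thetaClass_follandHermite_mem_of_box L 2 H e₁ dV hdV hdV0 ιA hT lam hlam a' hρ μW (charCM ξ) μ t ht g hg hpin v₀ u β hS hc _ Φf hγ Q hβ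

end Summit.HodgeConjecture.HodgeConjecture.Cruxes.HLiu418.F0LD1ThetaArchLadderOfBox

end
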